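/-
Copyright: the b2b-balaban T⁴-continuum CRUX team, row NE7b leaf lineage `t4-ne7b-formalise-leaf-02` (gen 136). Project licence.
-/
import Summits.QuantumFields.BalabanUV.T4Continuum.Spine.NE7b.CurlTermsLinear
import Summits.QuantumFields.BalabanUV.T4Continuum.Spine.NE7b.AverageTermsLinear
import Literature.MathematicalPhysics.QuantumFieldTheory.Balaban1983to89.B8Ineq132

/-!
# THE (cov) AND (iso) LETTERS OF THE (h2) SLOT FOR THE FULL FORM's OWN MAP FAMILIES: under a sitewise gauge `g` acting on bond fields by `x c ↦ R(g(c₋))x c`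
# and on the transports by `w ↦ g(base)·w·g(target)⁻¹`, CTL's curl maps and ATL's average maps transform by ONE conjugation at the term's base point —
# `Σ_c R^{g}_{P,c}(x^g c) = R(g(y_P))·Σ_c R_{P,c}(x c)`, `Σ_c R′^{g}_{j,c}(x^g c) = R(g(b_j))·Σ_c R′_{j,c}(x c)` — so every term's norm and the full form are
# gauge INVARIANT, and `x ↦ x^g` is an isometry of `Σ‖·‖²` ([B9] (3.29)–(3.32) for the linearised objects; `U1`-valued `g`, operator currency)
# (row NE7b, node U5c; residual (R2′) family (2), letter (ℓ1); E-side letters (cov)∕(iso) in `…AdmissibleFloorSeminormTwoFamilies`' own currency)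

Cell `pub-balaban`, sub-cell `t4`, spine estimate NE7b (`T4WeightBudget.RelWeightBound`; the cell's OWN estimate — NOT PRINTED in [Bałaban 1983–89],
NOT PROVED).  Crux-route work under `Spine/NE7b/` by a row leaf (`t4-ne7b-formalise-leaf-02`, E-side ∕ key-readings ∕ lattice-geometry lineage, gen 136)
under FREEZE (0)'s crux-prover clause; [folklore] algebra over landed modules BY NAME; NOTHING of Bałaban's is asserted; no `def` (map families by CTL's ∕ ATL's
characterising hypotheses `hR`, gauged transports by characterising hypotheses `hwg`); zero `sorry`; no `T4Continuum/Support` leaf.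
Imports (hub oleans built): this lineage's `…CurlTermsLinear` (CTL `sum_curlMaps_eq`) and `…AverageTermsLinear` (ATL `sum_avgMaps_eq`), and
`Literature.….B8Ineq132` (`conjR_conjR`, `conjR_sum`, `norm_conjR` — `R(u)` is an isometry for `u ∈ U1`, [B8] (1.32) context, PROVED).

WHY.  The U ≠ 1 road of the (h2) slot (leaf-05's `…AdmissibleFloorSeminormTwoFamilies.admissible_floor_linear_terms_two`, AFS2) asks per cube `s` for a
gauge `u_s` with (iso) `N′(u_s(h_s·x)) = Σ‖h_s·x‖²` and (cov) `Σ_P‖Σ_c R_{P,c}(h_s x)_c‖² + Σ_j‖Σ_c R′_{j,c}(h_s x)_c‖² = F′_s(u_s(h_s·x))` — the covariant full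
form with the GLOBAL transports equals a form with GAUGED transports at the gauged field (then (pert) ∕ (flat) run in the gauge where the transports near the
cube are close to `1`: `…TransportSubLetters`, `…FlatFullFormFloorTorus.flat_letter_torus`).  leaf-05's `…GaugeCovarianceLetters` typed (iso)∕(cov) in the
KERNEL's `⬝ᵥ` coordinates for orthogonal blockwise rotations; `…CoarseCurlTransportLetters.X_gaugeAct_eq` typed (cov) for the curl FUNCTIONAL of the
k = 1 instance.  THIS FILE types (cov)∕(iso) for CTL's and ATL's LINEAR MAP FAMILIES THEMSELVES, in the operator currency AFS2 ∕ FFSF run in, with the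
gauge acting sitewise by `R(g(c₋))` on the bond field and by `g(base)·w·g(target)⁻¹` on each transport: one conjugation per term, norms unchanged.

WHAT IS PROVED ([folklore]; `𝔸` normed ℂ-algebra with `‖1‖ = 1`; `g` sitewise units, `U1`-valued where norms are taken; CTL's `ι`∕`hR`, ATL's `ιA`∕`hR` VERBATIM):
* §1 **`sum_curlMaps_gaugeAct`** — with `wg P 0 = g(y_P)·w P 0·g((ι P 1)₋)⁻¹`, `wg P 1 = g(y_P)·w P 1·g((ι P 2)₋)⁻¹`, `wg P 2 = g(y_P)·w P 2·g((ι P 3)₋)⁻¹`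
  (`y_P = (ι P 0)₋`) and `R^{g}` = CTL's `hR` at `wg`: `Σ_{c∈image(ι P)} R^{g}_{P,c}(R(g(c₋))(x c)) = R(g(y_P))(Σ_{c∈image(ι P)} R_{P,c}(x c))`;
  **`norm_sum_curlMaps_gaugeAct`** (`g(y_P) ∈ U1` ⊢ the two norms are equal).
* §2 **`sum_avgMaps_gaugeAct`** — with ANY base point `b_j` per term, `wg′ j rt = g(b_j)·w′ j rt·g((ιA j rt)₋)⁻¹`, `R′^{g}` = ATL's `hR` at `wg′`:
  `Σ_{c∈image(ιA j)} R′^{g}_{j,c}(R(g(c₋))(x c)) = R(g(b_j))(Σ_{c∈image(ιA j)} R′_{j,c}(x c))`; **`norm_sum_avgMaps_gaugeAct`**.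
* §3 **`conjR_smul_cutoff`** (`R(g(c₋))(h c • x c) = h c • R(g(c₋))(x c)`), **`sum_normSq_gaugeAct`** ((iso): `Σ_c‖R(g(c₋))(x c)‖² = Σ_c‖x c‖²`).
* §4 **`full_form_gaugeAct`** — (cov) for the two families summed: `Σ_P‖Σ R^{g}(x^g)‖² + Σ_j‖Σ R′^{g}(x^g)‖² = Σ_P‖Σ R x‖² + Σ_j‖Σ R′ x‖²`.
* §5 toy: `g ≡ 1` — `wg = w` is an admissible gauged family (`example`).

NOT HERE (honest): WHICH gauge per cube ((π4) ∕ R-V local axial gauges — `…LocalGaugeTransportSize` gives the transports' size by value; OWNER ∕ (A3));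
the identification of `wg` with the holonomies of the gauge-transformed background `V₀^g` ((11) `bavg_gaugeAct` — CCTL's road; here `wg` is characterised
algebraically, which is all (cov) needs); the Hilbert–Schmidt currency (Q-leaf05-g157-1 UNRULED); anything of Bałaban's.  BY-NAME EFFECT ON THE WALL:
NONE.  NE7b NOT PRINTED ∕ NOT PROVED; spine PROVED 0∕9; rung (B)+1 on ONE finite T⁴ — NOT infinite volume, NOT the mass gap, NOT Clay.
HONEST DEPENDENCY: continuum YM on T⁴ ⇐ BetaPertH ∧ nine spine estimates (0/9 proved); BetaPertH ⇐ (D1) ∧ (D4) ∧ CAP+tail; G-an2-4 gates asym, D1 and NE2/3/4.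
-/

set_option autoImplicit false

noncomputable section

open Finset
open Literature.MathematicalPhysics.QuantumFieldTheory.Balaban1983to89.B7Prop1Explicit (U1)
open Literature.MathematicalPhysics.QuantumFieldTheory.Balaban1983to89.B7Eq78Linearization (conjR conjR_apply conjR_add conjR_sub conjR_smul_real)
open Literature.MathematicalPhysics.QuantumFieldTheory.Balaban1983to89.B8Ineq132 (conjR_conjR conjR_sum norm_conjR)
open Summit.QuantumFields.BalabanUV.T4Continuum.NE7b.CurlTermsLinear (sum_curlMaps_eq)
open Summit.QuantumFields.BalabanUV.T4Continuum.NE7b.AverageTermsLinear (sum_avgMaps_eq)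

namespace Summit.QuantumFields.BalabanUV.T4Continuum.NE7b.GaugedTermsCovariance

variable {d M : ℕ} (n : ℕ)
variable {𝔸 : Type*} [NormedRing 𝔸] [NormedAlgebra ℂ 𝔸] [NormOneClass 𝔸]

/-! ## §1 The curl maps under a sitewise gauge: one conjugation at the plaquette's base point -/

omit [NormOneClass 𝔸] in
/-- **(cov) FOR THE CURL MAPS**: with the gauged transports `wg P i = g(y_P)·w P i·g((ι P (i+1))₋)⁻¹` and `R^{g}` CTL's maps at `wg`,
`Σ_{c∈image(ι P)} R^{g}_{P,c}(R(g(c₋))(x c)) = R(g(y_P))·Σ_{c∈image(ι P)} R_{P,c}(x c)`, `y_P = (ι P 0)₋`. [folklore] -/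
theorem sum_curlMaps_gaugeAct [Fact (1 < M)]
    (ι : (Fin d → ZMod M) × {a : Fin d × Fin d // a.1 < a.2} → Fin 4 → (Fin d → ZMod M) × Fin d)
    (hι : ∀ x a, ι (x, a) = ![(x, a.1.1), (x + Pi.single a.1.1 1, a.1.2), (x + Pi.single a.1.2 1, a.1.1), (x, a.1.2)])
    (w : (Fin d → ZMod M) × {a : Fin d × Fin d // a.1 < a.2} → Fin 3 → 𝔸ˣ)
    (R : (Fin d → ZMod M) × {a : Fin d × Fin d // a.1 < a.2} → (Fin d → ZMod M) × Fin d → 𝔸 →ₗ[ℝ] 𝔸)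
    (hR : ∀ P c, R P c =
        if c = ι P 0 then LinearMap.id
        else if c = ι P 1 then LinearMap.mk ⟨conjR (w P 0), conjR_add (w P 0)⟩ (conjR_smul_real (w P 0))
        else if c = ι P 2 then -LinearMap.mk ⟨conjR (w P 1), conjR_add (w P 1)⟩ (conjR_smul_real (w P 1))
        else if c = ι P 3 then -LinearMap.mk ⟨conjR (w P 2), conjR_add (w P 2)⟩ (conjR_smul_real (w P 2))
        else 0)
    (g : (Fin d → ZMod M) → 𝔸ˣ)
    (wg : (Fin d → ZMod M) × {a : Fin d × Fin d // a.1 < a.2} → Fin 3 → 𝔸ˣ)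
    (hwg0 : ∀ P, wg P 0 = g (ι P 0).1 * w P 0 * (g (ι P 1).1)⁻¹)
    (hwg1 : ∀ P, wg P 1 = g (ι P 0).1 * w P 1 * (g (ι P 2).1)⁻¹)
    (hwg2 : ∀ P, wg P 2 = g (ι P 0).1 * w P 2 * (g (ι P 3).1)⁻¹)
    (Rg : (Fin d → ZMod M) × {a : Fin d × Fin d // a.1 < a.2} → (Fin d → ZMod M) × Fin d → 𝔸 →ₗ[ℝ] 𝔸)
    (hRg : ∀ P c, Rg P c =
        if c = ι P 0 then LinearMap.id
        else if c = ι P 1 then LinearMap.mk ⟨conjR (wg P 0), conjR_add (wg P 0)⟩ (conjR_smul_real (wg P 0))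
        else if c = ι P 2 then -LinearMap.mk ⟨conjR (wg P 1), conjR_add (wg P 1)⟩ (conjR_smul_real (wg P 1))
        else if c = ι P 3 then -LinearMap.mk ⟨conjR (wg P 2), conjR_add (wg P 2)⟩ (conjR_smul_real (wg P 2))
        else 0)
    (P : (Fin d → ZMod M) × {a : Fin d × Fin d // a.1 < a.2}) (x : (Fin d → ZMod M) × Fin d → 𝔸) :
    ∑ c ∈ Finset.univ.image (ι P), Rg P c (conjR (g c.1) (x c))
      = conjR (g (ι P 0).1) (∑ c ∈ Finset.univ.image (ι P), R P c (x c)) := by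
  rw [sum_curlMaps_eq ι hι wg Rg hRg P (fun c => conjR (g c.1) (x c)), sum_curlMaps_eq ι hι w R hR P x,
    hwg0, hwg1, hwg2, conjR_conjR, conjR_conjR, conjR_conjR, inv_mul_cancel_right, inv_mul_cancel_right,
    inv_mul_cancel_right, conjR_sub, conjR_sub, conjR_add, conjR_conjR, conjR_conjR, conjR_conjR]

/-- **THE CURL TERM's NORM IS GAUGE INVARIANT** (`g(y_P) ∈ U1`: `R(g(y_P))` is an isometry, `B8Ineq132.norm_conjR`). [folklore] -/
theorem norm_sum_curlMaps_gaugeAct [Fact (1 < M)]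
    (ι : (Fin d → ZMod M) × {a : Fin d × Fin d // a.1 < a.2} → Fin 4 → (Fin d → ZMod M) × Fin d)
    (hι : ∀ x a, ι (x, a) = ![(x, a.1.1), (x + Pi.single a.1.1 1, a.1.2), (x + Pi.single a.1.2 1, a.1.1), (x, a.1.2)])
    (w : (Fin d → ZMod M) × {a : Fin d × Fin d // a.1 < a.2} → Fin 3 → 𝔸ˣ)
    (R : (Fin d → ZMod M) × {a : Fin d × Fin d // a.1 < a.2} → (Fin d → ZMod M) × Fin d → 𝔸 →ₗ[ℝ] 𝔸)
    (hR : ∀ P c, R P c =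
        if c = ι P 0 then LinearMap.id
        else if c = ι P 1 then LinearMap.mk ⟨conjR (w P 0), conjR_add (w P 0)⟩ (conjR_smul_real (w P 0))
        else if c = ι P 2 then -LinearMap.mk ⟨conjR (w P 1), conjR_add (w P 1)⟩ (conjR_smul_real (w P 1))
        else if c = ι P 3 then -LinearMap.mk ⟨conjR (w P 2), conjR_add (w P 2)⟩ (conjR_smul_real (w P 2))
        else 0)
    (g : (Fin d → ZMod M) → 𝔸ˣ) (hg : ∀ y, g y ∈ U1 𝔸)
    (wg : (Fin d → ZMod M) × {a : Fin d × Fin d // a.1 < a.2} → Fin 3 → 𝔸ˣ)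
    (hwg0 : ∀ P, wg P 0 = g (ι P 0).1 * w P 0 * (g (ι P 1).1)⁻¹)
    (hwg1 : ∀ P, wg P 1 = g (ι P 0).1 * w P 1 * (g (ι P 2).1)⁻¹)
    (hwg2 : ∀ P, wg P 2 = g (ι P 0).1 * w P 2 * (g (ι P 3).1)⁻¹)
    (Rg : (Fin d → ZMod M) × {a : Fin d × Fin d // a.1 < a.2} → (Fin d → ZMod M) × Fin d → 𝔸 →ₗ[ℝ] 𝔸)
    (hRg : ∀ P c, Rg P c =
        if c = ι P 0 then LinearMap.id
        else if c = ι P 1 then LinearMap.mk ⟨conjR (wg P 0), conjR_add (wg P 0)⟩ (conjR_smul_real (wg P 0))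
        else if c = ι P 2 then -LinearMap.mk ⟨conjR (wg P 1), conjR_add (wg P 1)⟩ (conjR_smul_real (wg P 1))
        else if c = ι P 3 then -LinearMap.mk ⟨conjR (wg P 2), conjR_add (wg P 2)⟩ (conjR_smul_real (wg P 2))
        else 0)
    (P : (Fin d → ZMod M) × {a : Fin d × Fin d // a.1 < a.2}) (x : (Fin d → ZMod M) × Fin d → 𝔸) :
    ‖∑ c ∈ Finset.univ.image (ι P), Rg P c (conjR (g c.1) (x c))‖ = ‖∑ c ∈ Finset.univ.image (ι P), R P c (x c)‖ := by
  rw [sum_curlMaps_gaugeAct ι hι w R hR g wg hwg0 hwg1 hwg2 Rg hRg P x, norm_conjR (hg _)]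

/-! ## §2 The average maps under a sitewise gauge: one conjugation at the term's base point -/

omit [NormOneClass 𝔸] in
/-- **(cov) FOR THE AVERAGE MAPS**: with any base point `b_j` per term, the gauged path transports `wg′ j rt = g(b_j)·w′ j rt·g((ιA j rt)₋)⁻¹` and
`R′^{g}` ATL's maps at `wg′`: `Σ_{c∈image(ιA j)} R′^{g}_{j,c}(R(g(c₋))(x c)) = R(g(b_j))·Σ_{c∈image(ιA j)} R′_{j,c}(x c)`. [folklore] -/
theorem sum_avgMaps_gaugeAct
    (ιA : (Fin d → ZMod M) × Fin d → (Fin d → Fin n) × Fin n → (Fin d → ZMod (n * M)) × Fin d)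
    (ω : ℝ) (w' : (Fin d → ZMod M) × Fin d → (Fin d → Fin n) × Fin n → 𝔸ˣ)
    (R' : (Fin d → ZMod M) × Fin d → (Fin d → ZMod (n * M)) × Fin d → 𝔸 →ₗ[ℝ] 𝔸)
    (hR' : ∀ j c, R' j c = ω • ∑ rt ∈ Finset.univ.filter (fun rt => ιA j rt = c),
        LinearMap.mk ⟨conjR (w' j rt), conjR_add (w' j rt)⟩ (conjR_smul_real (w' j rt)))
    (g : (Fin d → ZMod (n * M)) → 𝔸ˣ) (base : (Fin d → ZMod M) × Fin d → (Fin d → ZMod (n * M)))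
    (wg' : (Fin d → ZMod M) × Fin d → (Fin d → Fin n) × Fin n → 𝔸ˣ)
    (hwg' : ∀ j rt, wg' j rt = g (base j) * w' j rt * (g (ιA j rt).1)⁻¹)
    (Rg' : (Fin d → ZMod M) × Fin d → (Fin d → ZMod (n * M)) × Fin d → 𝔸 →ₗ[ℝ] 𝔸)
    (hRg' : ∀ j c, Rg' j c = ω • ∑ rt ∈ Finset.univ.filter (fun rt => ιA j rt = c),
        LinearMap.mk ⟨conjR (wg' j rt), conjR_add (wg' j rt)⟩ (conjR_smul_real (wg' j rt)))
    (j : (Fin d → ZMod M) × Fin d) (x : (Fin d → ZMod (n * M)) × Fin d → 𝔸) :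
    ∑ c ∈ Finset.univ.image (ιA j), Rg' j c (conjR (g c.1) (x c))
      = conjR (g (base j)) (∑ c ∈ Finset.univ.image (ιA j), R' j c (x c)) := by
  rw [sum_avgMaps_eq n ιA ω wg' Rg' hRg' j (fun c => conjR (g c.1) (x c)), sum_avgMaps_eq n ιA ω w' R' hR' j x,
    conjR_smul_real, conjR_sum]
  congr 1
  refine Finset.sum_congr rfl fun rt _ => ?_
  rw [hwg', conjR_conjR, conjR_conjR, inv_mul_cancel_right]

/-- **THE AVERAGE TERM's NORM IS GAUGE INVARIANT** (`g(b_j) ∈ U1`). [folklore] -/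
theorem norm_sum_avgMaps_gaugeAct
    (ιA : (Fin d → ZMod M) × Fin d → (Fin d → Fin n) × Fin n → (Fin d → ZMod (n * M)) × Fin d)
    (ω : ℝ) (w' : (Fin d → ZMod M) × Fin d → (Fin d → Fin n) × Fin n → 𝔸ˣ)
    (R' : (Fin d → ZMod M) × Fin d → (Fin d → ZMod (n * M)) × Fin d → 𝔸 →ₗ[ℝ] 𝔸)
    (hR' : ∀ j c, R' j c = ω • ∑ rt ∈ Finset.univ.filter (fun rt => ιA j rt = c),
        LinearMap.mk ⟨conjR (w' j rt), conjR_add (w' j rt)⟩ (conjR_smul_real (w' j rt)))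
    (g : (Fin d → ZMod (n * M)) → 𝔸ˣ) (hg : ∀ y, g y ∈ U1 𝔸) (base : (Fin d → ZMod M) × Fin d → (Fin d → ZMod (n * M)))
    (wg' : (Fin d → ZMod M) × Fin d → (Fin d → Fin n) × Fin n → 𝔸ˣ)
    (hwg' : ∀ j rt, wg' j rt = g (base j) * w' j rt * (g (ιA j rt).1)⁻¹)
    (Rg' : (Fin d → ZMod M) × Fin d → (Fin d → ZMod (n * M)) × Fin d → 𝔸 →ₗ[ℝ] 𝔸)
    (hRg' : ∀ j c, Rg' j c = ω • ∑ rt ∈ Finset.univ.filter (fun rt => ιA j rt = c),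
        LinearMap.mk ⟨conjR (wg' j rt), conjR_add (wg' j rt)⟩ (conjR_smul_real (wg' j rt)))
    (j : (Fin d → ZMod M) × Fin d) (x : (Fin d → ZMod (n * M)) × Fin d → 𝔸) :
    ‖∑ c ∈ Finset.univ.image (ιA j), Rg' j c (conjR (g c.1) (x c))‖ = ‖∑ c ∈ Finset.univ.image (ιA j), R' j c (x c)‖ := by
  rw [sum_avgMaps_gaugeAct n ιA ω w' R' hR' g base wg' hwg' Rg' hRg' j x, norm_conjR (hg _)]

/-! ## §3 The gauge on bond fields: commutes with real cutoffs, isometry of `Σ‖·‖²` -/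

omit [NormOneClass 𝔸] in
/-- The sitewise gauge commutes with a real cutoff: `R(g(c₋))(h c • x c) = h c • R(g(c₋))(x c)`. [folklore] -/
theorem conjR_smul_cutoff {C S : Type*} (base : C → S) (g : S → 𝔸ˣ) (h : C → ℝ) (x : C → 𝔸) (c : C) :
    conjR (g (base c)) (h c • x c) = h c • conjR (g (base c)) (x c) :=
  conjR_smul_real _ _ _

omit [NormedAlgebra ℂ 𝔸] in
/-- **(iso)**: `Σ_c‖R(g(c₋))(x c)‖² = Σ_c‖x c‖²` for `U1`-valued `g`. [folklore] -/
theorem sum_normSq_gaugeAct {C S : Type*} [Fintype C] (base : C → S) (g : S → 𝔸ˣ) (hg : ∀ s, g s ∈ U1 𝔸) (x : C → 𝔸) :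
    ∑ c, ‖conjR (g (base c)) (x c)‖ ^ 2 = ∑ c, ‖x c‖ ^ 2 := by
  simp only [norm_conjR (hg _)]

/-! ## §4 (cov) for the full form: both families summed -/

/-- **(cov) FOR THE FULL FORM**: `Σ_P‖Σ_c R^{g}_{P,c}(x^g c)‖² + Σ_j‖Σ_c R′^{g}_{j,c}(x^g c)‖² = Σ_P‖Σ_c R_{P,c}(x c)‖² + Σ_j‖Σ_c R′_{j,c}(x c)‖²`, `x^g c = R(g(c₋))(x c)`
— AFS2's `hcov` with `F′_s` the form of the GAUGED families and `u_s x = x^{g_s}`. [folklore] -/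
theorem full_form_gaugeAct [Fact (1 < n * M)] [NeZero M] [NeZero (n * M)]
    (ι : (Fin d → ZMod (n * M)) × {a : Fin d × Fin d // a.1 < a.2} → Fin 4 → (Fin d → ZMod (n * M)) × Fin d)
    (hι : ∀ x a, ι (x, a) = ![(x, a.1.1), (x + Pi.single a.1.1 1, a.1.2), (x + Pi.single a.1.2 1, a.1.1), (x, a.1.2)])
    (w : (Fin d → ZMod (n * M)) × {a : Fin d × Fin d // a.1 < a.2} → Fin 3 → 𝔸ˣ)
    (R : (Fin d → ZMod (n * M)) × {a : Fin d × Fin d // a.1 < a.2} → (Fin d → ZMod (n * M)) × Fin d → 𝔸 →ₗ[ℝ] 𝔸)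
    (hR : ∀ P c, R P c =
        if c = ι P 0 then LinearMap.id
        else if c = ι P 1 then LinearMap.mk ⟨conjR (w P 0), conjR_add (w P 0)⟩ (conjR_smul_real (w P 0))
        else if c = ι P 2 then -LinearMap.mk ⟨conjR (w P 1), conjR_add (w P 1)⟩ (conjR_smul_real (w P 1))
        else if c = ι P 3 then -LinearMap.mk ⟨conjR (w P 2), conjR_add (w P 2)⟩ (conjR_smul_real (w P 2))
        else 0)
    (ιA : (Fin d → ZMod M) × Fin d → (Fin d → Fin n) × Fin n → (Fin d → ZMod (n * M)) × Fin d)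
    (ω : ℝ) (w' : (Fin d → ZMod M) × Fin d → (Fin d → Fin n) × Fin n → 𝔸ˣ)
    (R' : (Fin d → ZMod M) × Fin d → (Fin d → ZMod (n * M)) × Fin d → 𝔸 →ₗ[ℝ] 𝔸)
    (hR' : ∀ j c, R' j c = ω • ∑ rt ∈ Finset.univ.filter (fun rt => ιA j rt = c),
        LinearMap.mk ⟨conjR (w' j rt), conjR_add (w' j rt)⟩ (conjR_smul_real (w' j rt)))
    (g : (Fin d → ZMod (n * M)) → 𝔸ˣ) (hg : ∀ y, g y ∈ U1 𝔸) (base : (Fin d → ZMod M) × Fin d → (Fin d → ZMod (n * M)))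
    (wg : (Fin d → ZMod (n * M)) × {a : Fin d × Fin d // a.1 < a.2} → Fin 3 → 𝔸ˣ)
    (hwg0 : ∀ P, wg P 0 = g (ι P 0).1 * w P 0 * (g (ι P 1).1)⁻¹)
    (hwg1 : ∀ P, wg P 1 = g (ι P 0).1 * w P 1 * (g (ι P 2).1)⁻¹)
    (hwg2 : ∀ P, wg P 2 = g (ι P 0).1 * w P 2 * (g (ι P 3).1)⁻¹)
    (Rg : (Fin d → ZMod (n * M)) × {a : Fin d × Fin d // a.1 < a.2} → (Fin d → ZMod (n * M)) × Fin d → 𝔸 →ₗ[ℝ] 𝔸)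
    (hRg : ∀ P c, Rg P c =
        if c = ι P 0 then LinearMap.id
        else if c = ι P 1 then LinearMap.mk ⟨conjR (wg P 0), conjR_add (wg P 0)⟩ (conjR_smul_real (wg P 0))
        else if c = ι P 2 then -LinearMap.mk ⟨conjR (wg P 1), conjR_add (wg P 1)⟩ (conjR_smul_real (wg P 1))
        else if c = ι P 3 then -LinearMap.mk ⟨conjR (wg P 2), conjR_add (wg P 2)⟩ (conjR_smul_real (wg P 2))
        else 0)
    (wg' : (Fin d → ZMod M) × Fin d → (Fin d → Fin n) × Fin n → 𝔸ˣ)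
    (hwg' : ∀ j rt, wg' j rt = g (base j) * w' j rt * (g (ιA j rt).1)⁻¹)
    (Rg' : (Fin d → ZMod M) × Fin d → (Fin d → ZMod (n * M)) × Fin d → 𝔸 →ₗ[ℝ] 𝔸)
    (hRg' : ∀ j c, Rg' j c = ω • ∑ rt ∈ Finset.univ.filter (fun rt => ιA j rt = c),
        LinearMap.mk ⟨conjR (wg' j rt), conjR_add (wg' j rt)⟩ (conjR_smul_real (wg' j rt)))
    (x : (Fin d → ZMod (n * M)) × Fin d → 𝔸) :
    ∑ P, ‖∑ c ∈ Finset.univ.image (ι P), Rg P c (conjR (g c.1) (x c))‖ ^ 2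
        + ∑ j, ‖∑ c ∈ Finset.univ.image (ιA j), Rg' j c (conjR (g c.1) (x c))‖ ^ 2
      = ∑ P, ‖∑ c ∈ Finset.univ.image (ι P), R P c (x c)‖ ^ 2 + ∑ j, ‖∑ c ∈ Finset.univ.image (ιA j), R' j c (x c)‖ ^ 2 := by
  simp only [norm_sum_curlMaps_gaugeAct ι hι w R hR g hg wg hwg0 hwg1 hwg2 Rg hRg,
    norm_sum_avgMaps_gaugeAct n ιA ω w' R' hR' g hg base wg' hwg' Rg' hRg']

/-! ## §5 Toy: the trivial gauge -/

/- With `g ≡ 1` the gauged transports may be taken equal to the original ones (`1·w·1⁻¹ = w`): §1's hypotheses are inhabited and the identity reads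
`Σ R_{P,c}(R(1)(x c)) = R(1)(Σ R_{P,c}(x c))` (`d = 2`, `M = 3`). -/
example (w : (Fin 2 → ZMod 3) × {a : Fin 2 × Fin 2 // a.1 < a.2} → Fin 3 → 𝔸ˣ)
    (R : (Fin 2 → ZMod 3) × {a : Fin 2 × Fin 2 // a.1 < a.2} → (Fin 2 → ZMod 3) × Fin 2 → 𝔸 →ₗ[ℝ] 𝔸)
    (hR : ∀ P c, R P c =
        if c = (fun (q : (Fin 2 → ZMod 3) × {a : Fin 2 × Fin 2 // a.1 < a.2}) =>
            ![(q.1, q.2.1.1), (q.1 + Pi.single q.2.1.1 1, q.2.1.2), (q.1 + Pi.single q.2.1.2 1, q.2.1.1), (q.1, q.2.1.2)]) P 0 then LinearMap.id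
        else if c = (fun (q : (Fin 2 → ZMod 3) × {a : Fin 2 × Fin 2 // a.1 < a.2}) =>
            ![(q.1, q.2.1.1), (q.1 + Pi.single q.2.1.1 1, q.2.1.2), (q.1 + Pi.single q.2.1.2 1, q.2.1.1), (q.1, q.2.1.2)]) P 1
          then LinearMap.mk ⟨conjR (w P 0), conjR_add _⟩ (conjR_smul_real _)
        else if c = (fun (q : (Fin 2 → ZMod 3) × {a : Fin 2 × Fin 2 // a.1 < a.2}) =>
            ![(q.1, q.2.1.1), (q.1 + Pi.single q.2.1.1 1, q.2.1.2), (q.1 + Pi.single q.2.1.2 1, q.2.1.1), (q.1, q.2.1.2)]) P 2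
          then -LinearMap.mk ⟨conjR (w P 1), conjR_add _⟩ (conjR_smul_real _)
        else if c = (fun (q : (Fin 2 → ZMod 3) × {a : Fin 2 × Fin 2 // a.1 < a.2}) =>
            ![(q.1, q.2.1.1), (q.1 + Pi.single q.2.1.1 1, q.2.1.2), (q.1 + Pi.single q.2.1.2 1, q.2.1.1), (q.1, q.2.1.2)]) P 3
          then -LinearMap.mk ⟨conjR (w P 2), conjR_add _⟩ (conjR_smul_real _)
        else 0)
    (P : (Fin 2 → ZMod 3) × {a : Fin 2 × Fin 2 // a.1 < a.2}) (x : (Fin 2 → ZMod 3) × Fin 2 → 𝔸) :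
    ∑ c ∈ Finset.univ.image ((fun (q : (Fin 2 → ZMod 3) × {a : Fin 2 × Fin 2 // a.1 < a.2}) =>
            ![(q.1, q.2.1.1), (q.1 + Pi.single q.2.1.1 1, q.2.1.2), (q.1 + Pi.single q.2.1.2 1, q.2.1.1), (q.1, q.2.1.2)]) P),
        R P c (conjR ((fun _ => (1 : 𝔸ˣ)) c.1) (x c))
      = conjR ((fun _ => (1 : 𝔸ˣ)) (((fun (q : (Fin 2 → ZMod 3) × {a : Fin 2 × Fin 2 // a.1 < a.2}) =>
            ![(q.1, q.2.1.1), (q.1 + Pi.single q.2.1.1 1, q.2.1.2), (q.1 + Pi.single q.2.1.2 1, q.2.1.1), (q.1, q.2.1.2)]) P 0).1))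
          (∑ c ∈ Finset.univ.image ((fun (q : (Fin 2 → ZMod 3) × {a : Fin 2 × Fin 2 // a.1 < a.2}) =>
            ![(q.1, q.2.1.1), (q.1 + Pi.single q.2.1.1 1, q.2.1.2), (q.1 + Pi.single q.2.1.2 1, q.2.1.1), (q.1, q.2.1.2)]) P), R P c (x c)) :=
  haveI : Fact (1 < 3) := ⟨by norm_num⟩
  sum_curlMaps_gaugeAct _ (fun _ _ => rfl) w R hR (fun _ => 1) w (fun _ => by simp) (fun _ => by simp) (fun _ => by simp) R hR P x

end Summit.QuantumFields.BalabanUV.T4Continuum.NE7b.GaugedTermsCovariance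

end
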